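import Mathlib
import Summits.KontsevichZagierPeriods.Zeta5Search.CasoratianLawNoMultipole
import Summits.KontsevichZagierPeriods.Zeta5Search.DenomLaw.RuleR

/-!
# ζ(5) search — DENOM-LAW D1: PATH ACCOUNTING on every SHALLOW first-period cell (no pair block reaching `p`) is a THEOREM for general `b`; first-period kit

Cell `pub-zeta5`, track DENOM-LAW (denom-prover-d1 g6, 2026-08-24; tree imports only — the base file of the g6 series
`ThresholdFirstPeriod` / `RuleR2*` / `PathAccounting*`).  HONEST FRAMING: systematic search; MODEL/structure side — integer bookkeeping on
Brown–Zudilin parameter vectors plus ONE application of the tree's (CV)-without-multipoles theorem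
(`CasoratianLawNoMultipole.casoratianLaw_of_noMultipole`, gen-2 g8 / `singleRowLaw_holds`); nothing about ζ(5); no γ; no p-adic digit,
no linear form, no kernel value; no irrationality claim; records in print UNMOVED.

## What is proved (kernel-checked), for EVERY `b`
* (S-1) first-period kit for the RULE-R vocabulary of `DenomLaw/RuleR.lean`: `sorted7_chain`, `firstPeriod_pair`, `longCount_eq_card`,
  `pairFloors_expand` (the 21 pair digits written out), `pathWeight_le` / `cStar_le` (`C⋆ ≤ longCount + 6`: a Hamiltonian path's interior
  looped vertices inject into the parameters reaching `p`; six edges), `pathWeight_le_longCount_of_shallow` / `cStar_le_five_of_shallow`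
  (no pair block reaches `p` ⇒ `C⋆ ≤ min(longCount, 5)`), and `pathAccounting_of_value` (at `⌊d/p⌋ = 2` any bound `(a + 3) − N_p ≤ v` gives
  the literal conclusion of `DenomLaw.PathAccountingFirstPeriod`).
* (S-2) **`pathAccounting_shallow`: `DenomLaw.PathAccountingFirstPeriod`'s conclusion on every first-period cell with NO pair block
  reaching `p` (`b₀ − b₆ − b₇ < p`, i.e. `N_p = 0`) and `⌊d/p⌋ ≤ 1`**, and `pathAccounting_shallow_two` (the same with `⌊d/p⌋ = 2` and at
  most four parameters reaching `p`) — every sorted `b` in the polytope, every prime `p ≥ 5` with `p² > b₀ + 2`.  Mechanism: `N_p = 0` makes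
  every block but possibly the smallest shorter than `p` (`b₀ − 2b_k ≤ b₀ − b_k − b₇ < p`), so no residue class has two poles
  (`classPoleCount_le_one_of_short_blocks`) and (CV) holds (`casoratianLaw_of_noMultipole`): `v ≥ min(1, ⌊d/p⌋) − 0`, which is PATH's
  value there (`C⋆ ≤ 5`, resp. `≤ 4`).  prover-d1 g6's first-period census (2,500 random cells, primes 11..59, `b₀` uniform below `6p`): the
  two shallow types `⌊d/p⌋ ∈ {0, 1}`, `N_p = 0` are HALF of all sampled `(b, p)` (862 + 381 of 2,500) and THEOREM LB equals PATH's value on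
  each; this file proves PATH there for all `b` without the class bound.  The node stays OPEN elsewhere.
-/

namespace Summit.KontsevichZagierPeriods.Zeta5Search.DenomLaw.FirstPeriodKit

open Finset
open Summit.KontsevichZagierPeriods.Zeta5Search.CasoratianValuation (InPolytope pairFloors refund shift casoratian)
open Summit.KontsevichZagierPeriods.Zeta5Search.WedgeDictionary (dOf)
open Summit.KontsevichZagierPeriods.Zeta5Search.ClusterValuation (classPoleCount)
open Summit.KontsevichZagierPeriods.Zeta5Search.DenomLaw (Sorted7 FirstPeriod BlockGe longCount pathWeight cStar)

variable {b : ℕ → ℤ} {p : ℕ}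

/-! ### (S-1) first-period kit -/

/-- sorted lower parameters (`Sorted7`): the six consecutive inequalities `b₂ ≤ b₁, …, b₇ ≤ b₆`. -/
theorem sorted7_chain (hs : Sorted7 b) :
    b 2 ≤ b 1 ∧ b 3 ≤ b 2 ∧ b 4 ≤ b 3 ∧ b 5 ≤ b 4 ∧ b 6 ≤ b 5 ∧ b 7 ≤ b 6 :=
  ⟨hs 0 (by simp), hs 1 (by simp), hs 2 (by simp), hs 3 (by simp), hs 4 (by simp), hs 5 (by simp)⟩

/-- the first-period pair bounds: `b₀ − b_i − b_k ≤ 2p − 1` for all `1 ≤ i < k ≤ 7` (0-based `i < k < 7`). -/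
theorem firstPeriod_pair (hfp : FirstPeriod b p) {i k : ℕ} (hi : i < 7) (hk : k < 7) (hik : i < k) :
    b 0 - b (i + 1) - b (k + 1) ≤ 2 * (p : ℤ) - 1 := by
  have := hfp.2 i (Finset.mem_range.2 hi) k (Finset.mem_range.2 hk) hik
  linarith

/-- `longCount` as the cardinality of an explicitly known index set. -/
theorem longCount_eq_card (b : ℕ → ℤ) (p : ℕ) (S : Finset ℕ) (hS7 : S ⊆ Finset.range 7)
    (hS : ∀ i, i < 7 → ((p : ℤ) ≤ b (i + 1) ↔ i ∈ S)) : longCount b p = S.card := by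
  unfold longCount
  congr 1
  ext i
  simp only [Finset.mem_filter, Finset.mem_range]
  constructor
  · rintro ⟨hi, h⟩; exact (hS i hi).1 h
  · intro h; exact ⟨Finset.mem_range.1 (hS7 h), (hS i (Finset.mem_range.1 (hS7 h))).2 h⟩

/-- `pairFloors` written out as its 21 pair digits. -/
theorem pairFloors_expand (b : ℕ → ℤ) (p : ℕ) : pairFloors b p =
    (b 0 - b 1 - b 2) / (p : ℤ) + (b 0 - b 1 - b 3) / (p : ℤ) + (b 0 - b 1 - b 4) / (p : ℤ) + (b 0 - b 1 - b 5) / (p : ℤ) +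
      (b 0 - b 1 - b 6) / (p : ℤ) + (b 0 - b 1 - b 7) / (p : ℤ) +
    ((b 0 - b 2 - b 3) / (p : ℤ) + (b 0 - b 2 - b 4) / (p : ℤ) + (b 0 - b 2 - b 5) / (p : ℤ) + (b 0 - b 2 - b 6) / (p : ℤ) +
      (b 0 - b 2 - b 7) / (p : ℤ)) +
    ((b 0 - b 3 - b 4) / (p : ℤ) + (b 0 - b 3 - b 5) / (p : ℤ) + (b 0 - b 3 - b 6) / (p : ℤ) + (b 0 - b 3 - b 7) / (p : ℤ)) +
    ((b 0 - b 4 - b 5) / (p : ℤ) + (b 0 - b 4 - b 6) / (p : ℤ) + (b 0 - b 4 - b 7) / (p : ℤ)) +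
    ((b 0 - b 5 - b 6) / (p : ℤ) + (b 0 - b 5 - b 7) / (p : ℤ)) +
    (b 0 - b 6 - b 7) / (p : ℤ) := by
  unfold pairFloors
  simp [Finset.sum_range_succ]

/-- **a Hamiltonian path weighs at most `a + 6`**: its interior vertices reaching `p` are among the `longCount b p` parameters reaching
`p`, and it has six edges. -/
theorem pathWeight_le (b : ℕ → ℤ) (p : ℕ) (π : Equiv.Perm (Fin 7)) : pathWeight b p π ≤ longCount b p + 6 := by
  unfold pathWeight longCount
  have h1 : ((Finset.univ : Finset (Fin 5)).filter fun t => (p : ℤ) ≤ b ((π ⟨t.val + 1, by omega⟩).val + 1)).card ≤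
      ((Finset.range 7).filter fun i => (p : ℤ) ≤ b (i + 1)).card := by
    refine Finset.card_le_card_of_injOn (fun t : Fin 5 => (π ⟨t.val + 1, by omega⟩).val) ?_ ?_
    · intro t ht
      simp only [Finset.coe_filter, Finset.mem_univ, true_and, Set.mem_setOf_eq] at ht
      simp only [Finset.coe_filter, Finset.mem_range, Set.mem_setOf_eq]
      exact ⟨(π ⟨t.val + 1, by omega⟩).isLt, ht⟩
    · intro t _ t' _ h
      have h' : π ⟨t.val + 1, by omega⟩ = π ⟨t'.val + 1, by omega⟩ := Fin.ext h
      have h'' := π.injective h'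
      simp only [Fin.mk.injEq] at h''
      exact Fin.ext (by omega)
  have h2 : ((Finset.univ : Finset (Fin 6)).filter fun t =>
      (p : ℤ) ≤ b 0 - b ((π ⟨t.val, by omega⟩).val + 1) - b ((π ⟨t.val + 1, by omega⟩).val + 1)).card ≤ 6 :=
    le_trans (Finset.card_filter_le _ _) (by simp)
  omega

/-- **`C⋆ ≤ a + 6`.** -/
theorem cStar_le (b : ℕ → ℤ) (p : ℕ) : cStar b p ≤ longCount b p + 6 :=
  Finset.sup_le fun π _ => pathWeight_le b p π

/-- on a SHALLOW cell (no pair block reaches `p`) a Hamiltonian path has no heavy edge: its weight is at most `longCount b p` … -/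
theorem pathWeight_le_longCount_of_shallow (hsh : ∀ i k : ℕ, i < 7 → k < 7 → i ≠ k → b 0 - b (i + 1) - b (k + 1) < (p : ℤ))
    (π : Equiv.Perm (Fin 7)) : pathWeight b p π ≤ longCount b p := by
  unfold pathWeight longCount
  have h1 : ((Finset.univ : Finset (Fin 5)).filter fun t => (p : ℤ) ≤ b ((π ⟨t.val + 1, by omega⟩).val + 1)).card ≤
      ((Finset.range 7).filter fun i => (p : ℤ) ≤ b (i + 1)).card := by
    refine Finset.card_le_card_of_injOn (fun t : Fin 5 => (π ⟨t.val + 1, by omega⟩).val) ?_ ?_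
    · intro t ht
      simp only [Finset.coe_filter, Finset.mem_univ, true_and, Set.mem_setOf_eq] at ht
      simp only [Finset.coe_filter, Finset.mem_range, Set.mem_setOf_eq]
      exact ⟨(π ⟨t.val + 1, by omega⟩).isLt, ht⟩
    · intro t _ t' _ h
      have h' : π ⟨t.val + 1, by omega⟩ = π ⟨t'.val + 1, by omega⟩ := Fin.ext h
      have h'' := π.injective h'
      simp only [Fin.mk.injEq] at h''
      exact Fin.ext (by omega)
  have h2 : ((Finset.univ : Finset (Fin 6)).filter fun t =>
      (p : ℤ) ≤ b 0 - b ((π ⟨t.val, by omega⟩).val + 1) - b ((π ⟨t.val + 1, by omega⟩).val + 1)).card = 0 := by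
    refine Finset.card_eq_zero.2 (Finset.filter_eq_empty_iff.2 fun t _ => ?_)
    have hne : (π ⟨t.val, by omega⟩).val ≠ (π ⟨t.val + 1, by omega⟩).val := by
      intro h
      have := π.injective (Fin.ext h)
      simp [Fin.mk.injEq] at this
    have := hsh _ _ (π ⟨t.val, by omega⟩).isLt (π ⟨t.val + 1, by omega⟩).isLt hne
    linarith
  omega

/-- … and at most `5` (five interior vertices). -/
theorem pathWeight_le_five_of_shallow (hsh : ∀ i k : ℕ, i < 7 → k < 7 → i ≠ k → b 0 - b (i + 1) - b (k + 1) < (p : ℤ))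
    (π : Equiv.Perm (Fin 7)) : pathWeight b p π ≤ 5 := by
  unfold pathWeight
  have h1 : ((Finset.univ : Finset (Fin 5)).filter fun t => (p : ℤ) ≤ b ((π ⟨t.val + 1, by omega⟩).val + 1)).card ≤ 5 :=
    le_trans (Finset.card_filter_le _ _) (by simp)
  have h2 : ((Finset.univ : Finset (Fin 6)).filter fun t =>
      (p : ℤ) ≤ b 0 - b ((π ⟨t.val, by omega⟩).val + 1) - b ((π ⟨t.val + 1, by omega⟩).val + 1)).card = 0 := by
    refine Finset.card_eq_zero.2 (Finset.filter_eq_empty_iff.2 fun t _ => ?_)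
    have hne : (π ⟨t.val, by omega⟩).val ≠ (π ⟨t.val + 1, by omega⟩).val := by
      intro h
      have := π.injective (Fin.ext h)
      simp [Fin.mk.injEq] at this
    have := hsh _ _ (π ⟨t.val, by omega⟩).isLt (π ⟨t.val + 1, by omega⟩).isLt hne
    linarith
  omega

/-- `C⋆ ≤ longCount` and `C⋆ ≤ 5` on a shallow cell. -/
theorem cStar_le_of_shallow (hsh : ∀ i k : ℕ, i < 7 → k < 7 → i ≠ k → b 0 - b (i + 1) - b (k + 1) < (p : ℤ)) :
    cStar b p ≤ longCount b p ∧ cStar b p ≤ 5 :=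
  ⟨Finset.sup_le fun π _ => pathWeight_le_longCount_of_shallow hsh π,
   Finset.sup_le fun π _ => pathWeight_le_five_of_shallow hsh π⟩

/-- at `⌊d/p⌋ = 2` the right-hand side of `PathAccountingFirstPeriod` is at most `(a + 3) − N_p`; so any lower bound
`(a + 3) − N_p ≤ v` gives the node's conclusion. -/
theorem pathAccounting_of_value (hfd : dOf b / (p : ℤ) = 2) {v : ℤ}
    (hv : ((longCount b p : ℤ) + 3) - pairFloors b p ≤ v) :
    dOf b / (p : ℤ) - pairFloors b p - min (if 2 ≤ dOf b / (p : ℤ) then (1 : ℤ) else 0) (5 - (cStar b p : ℤ)) ≤ v := by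
  rw [hfd, if_pos (le_refl _)]
  have hc : (cStar b p : ℤ) ≤ (longCount b p : ℤ) + 6 := by exact_mod_cast cStar_le b p
  have hl : (0 : ℤ) ≤ longCount b p := by positivity
  have hmin : -1 - (longCount b p : ℤ) ≤ min (1 : ℤ) (5 - (cStar b p : ℤ)) := le_min (by linarith) (by linarith)
  linarith

/-! ### (S-2) shallow cells: no pair block reaches `p` -/

/-- on a sorted polytope vector, `b₀ − b₆ − b₇ < p` puts EVERY pair block below `p` … -/
theorem shallow_pairs (hs : Sorted7 b) (h67 : ¬ BlockGe b p 6 7) :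
    ∀ i k : ℕ, i < 7 → k < 7 → i ≠ k → b 0 - b (i + 1) - b (k + 1) < (p : ℤ) := by
  obtain ⟨s2, s3, s4, s5, s6, s7⟩ := sorted7_chain hs
  unfold BlockGe at h67
  push Not at h67
  have hge6 : ∀ i : ℕ, i < 6 → b 6 ≤ b (i + 1) := by
    intro i hi; interval_cases i <;> simp <;> linarith
  have e7 : b (6 + 1) = b 7 := rfl
  intro i k hi hk hik
  rcases Nat.lt_or_ge i 6 with hi6 | hi6
  · rcases Nat.lt_or_ge k 6 with hk6 | hk6
    · have := hge6 i hi6; have := hge6 k hk6; linarith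
    · have hk' : k = 6 := by omega
      subst hk'; rw [e7]; have := hge6 i hi6; linarith
  · have hi' : i = 6 := by omega
    subst hi'; rw [e7]; have := hge6 k (by omega); linarith

/-- … hence `N_p = 0` … -/
theorem pairFloors_eq_zero_of_shallow (hb : InPolytope b) (hs : Sorted7 b) (h67 : ¬ BlockGe b p 6 7) :
    pairFloors b p = 0 := by
  have P := shallow_pairs hs h67
  have nn : ∀ i k : ℕ, i < 7 → k < 7 → 0 ≤ b 0 - b (i + 1) - b (k + 1) := by
    intro i k hi hk
    have := hb.2.1 i (Finset.mem_range.2 hi); have := hb.2.1 k (Finset.mem_range.2 hk); linarith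
  have Z : ∀ i k : ℕ, i < 7 → k < 7 → i ≠ k → (b 0 - b (i + 1) - b (k + 1)) / (p : ℤ) = 0 :=
    fun i k hi hk hik => Int.ediv_eq_zero_of_lt (nn i k hi hk) (P i k hi hk hik)
  rw [pairFloors_expand,
    Z 0 1 (by norm_num) (by norm_num) (by norm_num), Z 0 2 (by norm_num) (by norm_num) (by norm_num),
    Z 0 3 (by norm_num) (by norm_num) (by norm_num), Z 0 4 (by norm_num) (by norm_num) (by norm_num),
    Z 0 5 (by norm_num) (by norm_num) (by norm_num), Z 0 6 (by norm_num) (by norm_num) (by norm_num),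
    Z 1 2 (by norm_num) (by norm_num) (by norm_num), Z 1 3 (by norm_num) (by norm_num) (by norm_num),
    Z 1 4 (by norm_num) (by norm_num) (by norm_num), Z 1 5 (by norm_num) (by norm_num) (by norm_num),
    Z 1 6 (by norm_num) (by norm_num) (by norm_num), Z 2 3 (by norm_num) (by norm_num) (by norm_num),
    Z 2 4 (by norm_num) (by norm_num) (by norm_num), Z 2 5 (by norm_num) (by norm_num) (by norm_num),
    Z 2 6 (by norm_num) (by norm_num) (by norm_num), Z 3 4 (by norm_num) (by norm_num) (by norm_num),
    Z 3 5 (by norm_num) (by norm_num) (by norm_num), Z 3 6 (by norm_num) (by norm_num) (by norm_num),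
    Z 4 5 (by norm_num) (by norm_num) (by norm_num), Z 4 6 (by norm_num) (by norm_num) (by norm_num),
    Z 5 6 (by norm_num) (by norm_num) (by norm_num)]
  norm_num

/-- … and no residue class has two poles (every block but the smallest parameter's is shorter than `p`). -/
theorem noMultipole_of_shallow (hb : InPolytope b) (hs : Sorted7 b) (hp5 : 5 ≤ p) (h67 : ¬ BlockGe b p 6 7) :
    ∀ x, x < p → classPoleCount b p x ≤ 1 := by
  have P := shallow_pairs hs h67
  obtain ⟨s2, s3, s4, s5, s6, s7⟩ := sorted7_chain hs
  intro x _
  refine ClusterValuation.classPoleCount_le_one_of_short_blocks b hb (by omega) (i := 6) (fun k hk => ?_) x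
  have hk6 : k < 7 ∧ k ≠ 6 := by simpa [Finset.mem_erase, Finset.mem_range, and_comm] using hk
  have h1 := P k 6 hk6.1 (by norm_num) hk6.2
  have h2 : b 7 ≤ b (k + 1) := by
    obtain ⟨hk7, _⟩ := hk6
    interval_cases k <;> simp <;> linarith
  have : b (6 + 1) = b 7 := rfl
  linarith

/-- **PATH ACCOUNTING ON SHALLOW CELLS, `⌊d/p⌋ ≤ 1`**: the literal conclusion of `DenomLaw.PathAccountingFirstPeriod` for every sorted
`b` in the polytope with `b + e₇` in the polytope, every prime `p ≥ 5` with `p² > b₀ + 2`, no pair block reaching `p` and `⌊d/p⌋ ≤ 1`. -/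
theorem pathAccounting_shallow (b : ℕ → ℤ) (p : ℕ) (hb : InPolytope b) (hs : Sorted7 b) (hb' : InPolytope (shift b 7))
    (hprime : p.Prime) (hp5 : 5 ≤ p) (hwin : (b 0 + 2 : ℤ) < (p : ℤ) ^ 2) (h67 : ¬ BlockGe b p 6 7)
    (hfd : dOf b / (p : ℤ) ≤ 1) (hcas : casoratian b 7 ≠ 0) :
    dOf b / (p : ℤ) - pairFloors b p - min (if 2 ≤ dOf b / (p : ℤ) then (1 : ℤ) else 0) (5 - (cStar b p : ℤ))
      ≤ padicValRat p (casoratian b 7) := by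
  haveI : Fact p.Prime := ⟨hprime⟩
  have hcv := ClusterValuation.casoratianLaw_of_noMultipole b hb (by norm_num) le_rfl hb' hp5 hwin
    (noMultipole_of_shallow hb hs hp5 h67) hcas
  have hN := pairFloors_eq_zero_of_shallow hb hs h67
  have hC : (cStar b p : ℤ) ≤ 5 := by exact_mod_cast (cStar_le_of_shallow (shallow_pairs hs h67)).2
  have hd0 : 0 ≤ dOf b / (p : ℤ) := Int.ediv_nonneg (by have := hb.2.2; unfold dOf; linarith) (by positivity)
  rw [hN, if_neg (by omega), min_eq_left (by linarith)]
  unfold refund at hcv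
  rw [hN, min_eq_right hfd] at hcv
  linarith

/-- **PATH ACCOUNTING ON SHALLOW CELLS, `⌊d/p⌋ = 2`** (then at most four parameters reach `p` is needed for `C⋆ ≤ 4`):
the node's conclusion is `1 ≤ v_p(Cas₇(b))`, which is (CV) without multipoles. -/
theorem pathAccounting_shallow_two (b : ℕ → ℤ) (p : ℕ) (hb : InPolytope b) (hs : Sorted7 b) (hb' : InPolytope (shift b 7))
    (hprime : p.Prime) (hp5 : 5 ≤ p) (hwin : (b 0 + 2 : ℤ) < (p : ℤ) ^ 2) (h67 : ¬ BlockGe b p 6 7)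
    (hfd : dOf b / (p : ℤ) = 2) (ha : longCount b p ≤ 4) (hcas : casoratian b 7 ≠ 0) :
    dOf b / (p : ℤ) - pairFloors b p - min (if 2 ≤ dOf b / (p : ℤ) then (1 : ℤ) else 0) (5 - (cStar b p : ℤ))
      ≤ padicValRat p (casoratian b 7) := by
  haveI : Fact p.Prime := ⟨hprime⟩
  have hcv := ClusterValuation.casoratianLaw_of_noMultipole b hb (by norm_num) le_rfl hb' hp5 hwin
    (noMultipole_of_shallow hb hs hp5 h67) hcas
  have hN := pairFloors_eq_zero_of_shallow hb hs h67
  have hC : (cStar b p : ℤ) ≤ 4 := by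
    have := (cStar_le_of_shallow (shallow_pairs hs h67)).1; omega
  rw [hN, hfd, if_pos (le_refl _), min_eq_left (by linarith)]
  unfold refund at hcv
  rw [hN, hfd] at hcv
  norm_num at hcv ⊢
  linarith

end Summit.KontsevichZagierPeriods.Zeta5Search.DenomLaw.FirstPeriodKit
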